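import Summits.QuantumFields.YangMills.Theorems.FluctuationComparisonRegPrIntLS2BetaCriticalFamily
import Mathlib.Analysis.SpecialFunctions.Exp
import HarnessLib

/-!
# S2β · LAPLACE row — (DET-REP-B glue): THE RESPONSE EQUATION OF A CRITICAL FAMILY, and LOCALISATION OF A DECAYING KERNEL APPLIED TO A LOCALISED VECTOR (pen w5-20520 g14)

Cell `ym3-torus` (rung R3: continuum `SU(2)` Yang–Mills on `T³` — NOT `d = 4`, NOT infinite volume, NOT a mass gap, NOT Clay); width seat `ym-ust-20520-w5` g14;
helper of the crux `stmt-QuantumFields-20520` (`--supports`, NOT a proof of it).  THEOREMS ONLY (0 `def`, 0 `sorry`; default heartbeats); generic.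

WHY (FOUR-POINT-DECAY v11 = DET-REP-A ⊕ DET-REP-B; DET-REP-B's heart is BRD, «background response decay»: the minimiser coordinate `y(s)` responds to a one-bond
change of the datum with an exponentially localised derivative, because `y′ = −H⁻¹ ∂ₛ∇f` with `H⁻¹` exponentially decaying (Combes–Thomas ∕ [Balaban1984PropagatorsII]
(1.33)) and `∂ₛ∇f` supported near the bond).  Two generic bricks for whoever types BRD:
* §1 ★★ `response_equation` — for the critical family of ✓IFT-min (`…CriticalFamily.contDiffAt_of_criticalFamily`): `H ∘ y′(0) + ∂ₛ(D₂f)(0, y 0) = 0`, i.e.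
  `((D[D₂f](0,y 0)) ∘ inr) ∘ (Dy 0) = −(D[D₂f](0,y 0)) ∘ inl` — the linear RESPONSE EQUATION (no inverse named; the consumer applies its own `H⁻¹`).
* §2 ★★ `abs_sum_kernel_le_of_decay` — `|Σ_c K a c · v c| ≤ α·δ·S·e^{−θ₂·d a}` when `|K a c| ≤ α e^{−θ·dist a c}`, `|v c| ≤ δ e^{−θ d′ c}`, `d a ≤ dist a c + d′ c`,
  `0 ≤ θ₂ ≤ θ`, and the LOCAL sum `Σ_c e^{−(θ−θ₂)·dist a c} ≤ S` — the locally-summed shape of px19's D-SUM letters (depth-uniform constants).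

HONEST SCOPE.  Generic calculus ∕ finite sums; proves no stub; BRD ∕ (LOC) ∕ (JAC) ∕ FOUR-POINT-DECAY ∕ LAPLACE ∕ S2β ∕ the crux 20520 NOT proved; `YM3TorusSU2` NOT proved;
the Yang–Mills mass gap (Clay) NOT proved.

References: [Dieudonne1960] Ch. X §2 (10.2.1)–(10.2.3); [Balaban1984PropagatorsII] CMP 96 (1984) (1.33); [Balaban1985Variational] CMP 102 (1985) Thm 1 (9)–(10) p. 279.
-/

noncomputable section

open scoped Topology ContDiff
open Filter Set Function Finset
open Summit.QuantumFields.YangMills.Theorems.FluctuationComparisonRegPrIntLS2BetaCriticalFamily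

namespace Summit.QuantumFields.YangMills.Theorems.FluctuationComparisonRegPrIntLS2BetaResponseGlue

/-! ## §1 The response equation of a critical family -/

/-- ★★ **THE RESPONSE EQUATION.**  In the setting of ✓`contDiffAt_of_criticalFamily` (`f` of class `C^{n+1}`, `n ≠ 0`, `y` a continuous family of critical points of
`f(s,·)` near `0`, slice Hessian invertible at `(0, y 0)`): differentiating `D₂f(s, y s) ≡ 0` at `s = 0` gives
`((D[q ↦ Df q ∘ inr](0, y 0)) ∘ inr) ∘ Dy(0) + (D[q ↦ Df q ∘ inr](0, y 0)) ∘ inl = 0` — «`H·y′ = −∂ₛ∇f`».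
[cite: Dieudonne1960, Ch. X §2 (10.2.1)–(10.2.3)] [cite: Balaban1985Variational, Thm 1 (9)-(10) p.279 (the background's response)] -/
theorem response_equation {S E : Type*} [NormedAddCommGroup S] [NormedSpace ℝ S] [CompleteSpace S] [NormedAddCommGroup E] [NormedSpace ℝ E]
    [CompleteSpace E] {f : S × E → ℝ} {y : S → E} {n : WithTop ℕ∞} (hn : n ≠ 0)
    (hf : ContDiffAt ℝ (n + 1) f (0, y 0))
    (hcrit : ∀ᶠ s in 𝓝 (0 : S), fderiv ℝ (fun e => f (s, e)) (y s) = 0)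
    (hy : ContinuousAt y 0)
    (hH : ((fderiv ℝ (fun q : S × E => (fderiv ℝ f q).comp (ContinuousLinearMap.inr ℝ S E)) (0, y 0)).comp
      (ContinuousLinearMap.inr ℝ S E)).IsInvertible) :
    ((fderiv ℝ (fun q : S × E => (fderiv ℝ f q).comp (ContinuousLinearMap.inr ℝ S E)) (0, y 0)).comp (ContinuousLinearMap.inr ℝ S E)).comp
        (fderiv ℝ y 0) +
      (fderiv ℝ (fun q : S × E => (fderiv ℝ f q).comp (ContinuousLinearMap.inr ℝ S E)) (0, y 0)).comp (ContinuousLinearMap.inl ℝ S E) = 0 := by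
  set Φ : S × E → E →L[ℝ] ℝ := fun q => (fderiv ℝ f q).comp (ContinuousLinearMap.inr ℝ S E) with hΦ
  have hys : ContDiffAt ℝ n y 0 := contDiffAt_of_criticalFamily hn hf hcrit hy hH
  have hyd : DifferentiableAt ℝ y 0 := hys.differentiableAt hn
  have hΦn : ContDiffAt ℝ n Φ (0, y 0) := contDiffAt_partialFDeriv hf
  have hΦd : DifferentiableAt ℝ Φ (0, y 0) := hΦn.differentiableAt hn
  -- `s ↦ Φ (s, y s)` vanishes near `0`
  have h1 : (1 : WithTop ℕ∞) ≤ n + 1 := le_add_self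
  have hdiff : ∀ᶠ q in 𝓝 ((0 : S), y 0), DifferentiableAt ℝ f q :=
    ((hf.of_le h1).eventually (by simp)).mono fun q hq => hq.differentiableAt one_ne_zero
  have htend : Tendsto (fun s => ((s : S), y s)) (𝓝 0) (𝓝 (0, y 0)) := tendsto_id.prodMk_nhds hy.tendsto
  have hzero : (fun s : S => Φ (s, y s)) =ᶠ[𝓝 0] fun _ => 0 := by
    filter_upwards [hcrit, htend.eventually hdiff] with s hs hds
    show (fderiv ℝ f (s, y s)).comp (ContinuousLinearMap.inr ℝ S E) = 0
    rw [← fderiv_slice_eq_comp_inr hds, hs]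
  have hD0 : fderiv ℝ (fun s : S => Φ (s, y s)) 0 = 0 := by
    rw [hzero.fderiv_eq]; exact fderiv_const_apply 0
  -- chain rule for `s ↦ Φ (s, y s)`
  have hpair : HasFDerivAt (fun s : S => ((s : S), y s)) ((ContinuousLinearMap.id ℝ S).prod (fderiv ℝ y 0)) 0 :=
    (hasFDerivAt_id 0).prodMk hyd.hasFDerivAt
  have hcomp : HasFDerivAt (Φ ∘ fun s : S => ((s : S), y s)) ((fderiv ℝ Φ (0, y 0)).comp ((ContinuousLinearMap.id ℝ S).prod (fderiv ℝ y 0))) 0 :=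
    HasFDerivAt.comp (0 : S) hΦd.hasFDerivAt hpair
  have hchain : fderiv ℝ (fun s : S => Φ (s, y s)) 0 = (fderiv ℝ Φ (0, y 0)).comp ((ContinuousLinearMap.id ℝ S).prod (fderiv ℝ y 0)) :=
    hcomp.fderiv
  rw [hchain] at hD0
  -- split `L ∘ (id × y′) = L ∘ inl + (L ∘ inr) ∘ y′`
  have hsplit : (fderiv ℝ Φ (0, y 0)).comp ((ContinuousLinearMap.id ℝ S).prod (fderiv ℝ y 0)) =
      ((fderiv ℝ Φ (0, y 0)).comp (ContinuousLinearMap.inr ℝ S E)).comp (fderiv ℝ y 0) +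
        (fderiv ℝ Φ (0, y 0)).comp (ContinuousLinearMap.inl ℝ S E) := by
    ext v w
    simp only [ContinuousLinearMap.comp_apply, ContinuousLinearMap.prod_apply, ContinuousLinearMap.id_apply, add_apply,
      ContinuousLinearMap.inr_apply, ContinuousLinearMap.inl_apply]
    rw [← add_apply, ← map_add, Prod.mk_add_mk, zero_add, add_zero]
  rw [hsplit] at hD0
  exact hD0

/-! ## §2 A decaying kernel applied to a localised vector is localised -/

/-- ★★ **KERNEL × LOCALISED VECTOR IS LOCALISED (locally-summed constant).**  Finite index types; `dist : ι → κ → ℕ`, profiles `d : ι → ℕ`, `d′ : κ → ℕ` with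
`d a ≤ dist a c + d′ c`; `|K a c| ≤ α·e^{−θ·dist a c}`, `|v c| ≤ δ·e^{−θ·d′ c}`, `0 ≤ θ₂ ≤ θ`, `Σ_c e^{−(θ−θ₂)·dist a c} ≤ S`.  Then
`|Σ_c K a c · v c| ≤ α·δ·S·e^{−θ₂·d a}`.  (The BRD step `y′ = −H⁻¹∂ₛ∇f`: `H⁻¹` decays, `∂ₛ∇f` is supported near the moved bond, so `y′` is localised there — with the
depth-uniform LOCAL sum `S`, as in px19's D-SUM letters.) [cite: Balaban1984PropagatorsII, (1.33) (the decaying kernel)] -/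
theorem abs_sum_kernel_le_of_decay {ι κ : Type*} [Fintype κ] (dist : ι → κ → ℕ) (d : ι → ℕ) (d' : κ → ℕ)
    (htri : ∀ a c, d a ≤ dist a c + d' c)
    {K : ι → κ → ℝ} {v : κ → ℝ} {α δ θ θ₂ S : ℝ} (hα : 0 ≤ α) (hδ : 0 ≤ δ) (hθ₂ : 0 ≤ θ₂) (hθ : θ₂ ≤ θ)
    (hK : ∀ a c, |K a c| ≤ α * Real.exp (-(θ * dist a c)))
    (hv : ∀ c, |v c| ≤ δ * Real.exp (-(θ * d' c)))
    (hS : ∀ a, ∑ c, Real.exp (-((θ - θ₂) * dist a c)) ≤ S) (a : ι) :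
    |∑ c, K a c * v c| ≤ α * δ * S * Real.exp (-(θ₂ * d a)) := by
  have hθ0 : 0 ≤ θ := hθ₂.trans hθ
  -- termwise bound
  have hterm : ∀ c, |K a c * v c| ≤ α * δ * Real.exp (-(θ₂ * d a)) * Real.exp (-((θ - θ₂) * dist a c)) := by
    intro c
    rw [abs_mul]
    have h1 := hK a c
    have h2 := hv c
    have hKv : |K a c| * |v c| ≤ (α * Real.exp (-(θ * dist a c))) * (δ * Real.exp (-(θ * d' c))) :=
      mul_le_mul h1 h2 (abs_nonneg _) (by positivity)
    refine hKv.trans ?_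
    -- exponent bookkeeping: θ·dist + θ·d′ ≥ θ₂·d a + (θ−θ₂)·dist  (uses d a ≤ dist + d′, θ₂ ≤ θ)
    have hexp : Real.exp (-(θ * dist a c)) * Real.exp (-(θ * d' c)) ≤ Real.exp (-(θ₂ * d a)) * Real.exp (-((θ - θ₂) * dist a c)) := by
      rw [← Real.exp_add, ← Real.exp_add]
      apply Real.exp_le_exp.2
      have hd : (d a : ℝ) ≤ dist a c + d' c := by exact_mod_cast htri a c
      have hdist0 : (0 : ℝ) ≤ dist a c := by positivity
      have hd'0 : (0 : ℝ) ≤ d' c := by positivity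
      nlinarith [mul_le_mul_of_nonneg_left hd hθ₂, mul_nonneg (sub_nonneg.2 hθ) hd'0]
    calc α * Real.exp (-(θ * dist a c)) * (δ * Real.exp (-(θ * d' c)))
        = α * δ * (Real.exp (-(θ * dist a c)) * Real.exp (-(θ * d' c))) := by ring
      _ ≤ α * δ * (Real.exp (-(θ₂ * d a)) * Real.exp (-((θ - θ₂) * dist a c))) := by
          exact mul_le_mul_of_nonneg_left hexp (by positivity)
      _ = α * δ * Real.exp (-(θ₂ * d a)) * Real.exp (-((θ - θ₂) * dist a c)) := by ring
  calc |∑ c, K a c * v c| ≤ ∑ c, |K a c * v c| := abs_sum_le_sum_abs _ _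
    _ ≤ ∑ c, α * δ * Real.exp (-(θ₂ * d a)) * Real.exp (-((θ - θ₂) * dist a c)) := sum_le_sum fun c _ => hterm c
    _ = α * δ * Real.exp (-(θ₂ * d a)) * ∑ c, Real.exp (-((θ - θ₂) * dist a c)) := by rw [mul_sum]
    _ ≤ α * δ * Real.exp (-(θ₂ * d a)) * S := mul_le_mul_of_nonneg_left (hS a) (by positivity)
    _ = α * δ * S * Real.exp (-(θ₂ * d a)) := by ring

end Summit.QuantumFields.YangMills.Theorems.FluctuationComparisonRegPrIntLS2BetaResponseGlue

end
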